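import Mathlib
import Summits.ABC.ABC.Statement
import HarnessLib

/-!
# Shapes E and F are effective away from Wieferich primes (solo-blind seat, session 5)

Shapes E (`1 + 2^k = p^m q^n`) and F (`1 + p^m q^n = 2^k`) of the first open support: by lifting the exponent over
the base `2^(p-1)` (Fermat), `p^m ∣ 2^k - 1` gives `m ≤ v_p(2^(p-1) - 1) + v_p(k)`, hence `p^m ≤ p·k` as soon as `p` is
not a base-2 Wieferich prime (`p² ∤ 2^(p-1) - 1`).  Consequently, when neither odd prime of the support is Wieferich,
`c = 2^k ≤ p q k² + 1` in shape F and `c = 2^k + 1 ≤ 4 p q k² + 1` in shape E — abc holds there EFFECTIVELY, with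
`c ≤ 4·rad·(log₂ c)²`.  The only non-effective residue of shapes E/F is therefore a Wieferich prime in the support
(the residue R3 of the atlas), now a kernel statement.

* `prime_pow_le_of_dvd_two_pow_sub_one` : `p^m ∣ 2^k - 1`, `p` odd non-Wieferich, `k ≥ 1` ⇒ `p^m ≤ p k`.
* `shapeF_effective` : `2^k - 1 = p^m q^n` (both non-Wieferich) ⇒ `2^k ≤ p q k² + 1`.
* `shapeE_effective` : `2^k + 1 = p^m q^n` (both non-Wieferich) ⇒ `2^k + 1 ≤ 4 p q k² + 1`.
* `prime_pow_le_level_mul` : in general `p^m ∣ 2^k - 1` ⇒ `p^m ≤ W₂(p)·k` with the WIEFERICH LEVEL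
  `W₂(p) := p ^ v_p(2^(p-1) - 1)`; hence `shapeF_level` / `shapeE_level` : `c ≤ 4·W₂(p)·W₂(q)·k² + 1` on shapes E/F unconditionally —
  abc on these two shapes is exactly a question about Wieferich levels of the two odd primes of the support.
-/

namespace Summit.ABC.ABC.Theorems

/-- **LTE bound.** If `p` is an odd prime with `p² ∤ 2^(p-1) - 1`, `k ≥ 1` and `p^m ∣ 2^k - 1`, then `p^m ≤ p·k`. -/
theorem prime_pow_le_of_dvd_two_pow_sub_one {p m k : ℕ} (hp : p.Prime) (hp2 : p ≠ 2)
    (hW : ¬ p ^ 2 ∣ 2 ^ (p - 1) - 1) (hk : 1 ≤ k) (hd : p ^ m ∣ 2 ^ k - 1) : p ^ m ≤ p * k := by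
  haveI := Fact.mk hp
  have hp3 : 3 ≤ p := by have := hp.two_le; omega
  -- Fermat: `p ∣ 2^(p-1) - 1`, and `2^(p-1) - 1 ≠ 0`
  have hF : p ∣ 2 ^ (p - 1) - 1 := by
    have hcop : Nat.Coprime 2 p := (Nat.coprime_primes Nat.prime_two hp).mpr hp2.symm
    have h1 : 1 ≤ 2 ^ (p - 1) := Nat.one_le_two_pow
    exact (Nat.modEq_iff_dvd' h1).mp (Nat.ModEq.pow_card_sub_one_eq_one hp hcop).symm
  have h4 : 4 ≤ 2 ^ (p - 1) :=
    calc 4 = 2 ^ 2 := by norm_num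
      _ ≤ 2 ^ (p - 1) := Nat.pow_le_pow_right (by norm_num) (by omega)
  have hne : 2 ^ (p - 1) - 1 ≠ 0 := by omega
  -- non-Wieferich: `v_p(2^(p-1) - 1) ≤ 1`
  have hv1 : padicValNat p (2 ^ (p - 1) - 1) ≤ 1 := by
    by_contra hlt
    exact hW ((padicValNat_dvd_iff_le hne).mpr (by omega))
  -- LTE over the base `2^(p-1)`: `v_p(2^((p-1)k) - 1) = v_p(2^(p-1) - 1) + v_p(k)`
  have hnot : ¬ p ∣ 2 ^ (p - 1) := by
    intro h'
    exact hp2 ((Nat.prime_dvd_prime_iff_eq hp Nat.prime_two).mp (hp.dvd_of_dvd_pow h'))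
  have hlte := padicValNat.pow_sub_pow (hp.odd_of_ne_two hp2) (show 1 < 2 ^ (p - 1) by omega)
    (by simpa using hF) hnot (show k ≠ 0 by omega)
  rw [one_pow, ← pow_mul] at hlte
  -- `p^m ∣ 2^k - 1 ∣ 2^((p-1)k) - 1`
  have hbig : 2 ^ ((p - 1) * k) - 1 ≠ 0 := by
    have : 2 ^ (p - 1) ≤ 2 ^ ((p - 1) * k) := Nat.pow_le_pow_right (by norm_num) (Nat.le_mul_of_pos_right _ hk)
    omega
  have hd' : p ^ m ∣ 2 ^ ((p - 1) * k) - 1 := by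
    refine hd.trans ?_
    simpa [one_pow, mul_comm] using Nat.pow_sub_pow_dvd_pow_sub_pow 2 1 (Dvd.intro_left (p - 1) rfl : k ∣ (p - 1) * k)
  have hm : m ≤ padicValNat p (2 ^ ((p - 1) * k) - 1) := (padicValNat_dvd_iff_le hbig).mp hd'
  rw [hlte] at hm
  -- so `m ≤ 1 + v_p(k)` and `p^m ≤ p · p^(v_p k) ≤ p k`
  have hpk : p ^ padicValNat p k ≤ k := Nat.le_of_dvd (by omega) pow_padicValNat_dvd
  calc p ^ m ≤ p ^ (1 + padicValNat p k) := Nat.pow_le_pow_right hp.pos (by omega)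
    _ = p * p ^ padicValNat p k := by rw [pow_add, pow_one]
    _ ≤ p * k := Nat.mul_le_mul_left p hpk

/-- **Shape F is effective away from Wieferich primes.** If `2^k - 1 = p^m q^n` with `p, q` odd primes that are not
base-2 Wieferich primes, then `2^k ≤ p q k² + 1`. -/
theorem shapeF_effective {k m n p q : ℕ} (hp : p.Prime) (hq : q.Prime) (hp2 : p ≠ 2) (hq2 : q ≠ 2)
    (hWp : ¬ p ^ 2 ∣ 2 ^ (p - 1) - 1) (hWq : ¬ q ^ 2 ∣ 2 ^ (q - 1) - 1) (hk : 1 ≤ k)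
    (h : 2 ^ k - 1 = p ^ m * q ^ n) : 2 ^ k ≤ p * q * k ^ 2 + 1 := by
  have hpm : p ^ m ≤ p * k :=
    prime_pow_le_of_dvd_two_pow_sub_one hp hp2 hWp hk (h ▸ Dvd.intro _ rfl)
  have hqn : q ^ n ≤ q * k :=
    prime_pow_le_of_dvd_two_pow_sub_one hq hq2 hWq hk (h ▸ Dvd.intro_left _ rfl)
  have : p ^ m * q ^ n ≤ p * k * (q * k) := Nat.mul_le_mul hpm hqn
  have h1 : 1 ≤ 2 ^ k := Nat.one_le_two_pow
  have : 2 ^ k - 1 ≤ p * q * k ^ 2 := by rw [h]; nlinarith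
  omega

/-- **Shape E is effective away from Wieferich primes.** If `2^k + 1 = p^m q^n` with `p, q` odd primes that are not
base-2 Wieferich primes, then `2^k + 1 ≤ 4 p q k² + 1` (via `2^k + 1 ∣ 2^(2k) - 1`). -/
theorem shapeE_effective {k m n p q : ℕ} (hp : p.Prime) (hq : q.Prime) (hp2 : p ≠ 2) (hq2 : q ≠ 2)
    (hWp : ¬ p ^ 2 ∣ 2 ^ (p - 1) - 1) (hWq : ¬ q ^ 2 ∣ 2 ^ (q - 1) - 1) (hk : 1 ≤ k)
    (h : 2 ^ k + 1 = p ^ m * q ^ n) : 2 ^ k + 1 ≤ 4 * p * q * k ^ 2 + 1 := by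
  have hfac : 2 ^ (2 * k) - 1 = (2 ^ k - 1) * (2 ^ k + 1) := by
    have h1 : 1 ≤ 2 ^ k := Nat.one_le_two_pow
    have h3 : 1 ≤ 2 ^ (2 * k) := Nat.one_le_two_pow
    zify [h1, h3]
    ring
  have hE : 2 ^ k + 1 ∣ 2 ^ (2 * k) - 1 := hfac ▸ Dvd.intro_left _ rfl
  have hpm : p ^ m ≤ p * (2 * k) :=
    prime_pow_le_of_dvd_two_pow_sub_one hp hp2 hWp (by omega) ((h ▸ Dvd.intro _ rfl : p ^ m ∣ 2 ^ k + 1).trans hE)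
  have hqn : q ^ n ≤ q * (2 * k) :=
    prime_pow_le_of_dvd_two_pow_sub_one hq hq2 hWq (by omega)
      ((h ▸ Dvd.intro_left _ rfl : q ^ n ∣ 2 ^ k + 1).trans hE)
  have : p ^ m * q ^ n ≤ p * (2 * k) * (q * (2 * k)) := Nat.mul_le_mul hpm hqn
  rw [h]
  nlinarith


/-- **LTE bound, general form.** If `p` is an odd prime, `k ≥ 1` and `p^m ∣ 2^k - 1`, then `p^m ≤ W₂(p)·k`. -/
theorem prime_pow_le_level_mul {p m k : ℕ} (hp : p.Prime) (hp2 : p ≠ 2) (hk : 1 ≤ k)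
    (hd : p ^ m ∣ 2 ^ k - 1) : p ^ m ≤ p ^ padicValNat p (2 ^ (p - 1) - 1) * k := by
  haveI := Fact.mk hp
  have hp3 : 3 ≤ p := by have := hp.two_le; omega
  have hF : p ∣ 2 ^ (p - 1) - 1 := by
    have hcop : Nat.Coprime 2 p := (Nat.coprime_primes Nat.prime_two hp).mpr hp2.symm
    have h1 : 1 ≤ 2 ^ (p - 1) := Nat.one_le_two_pow
    exact (Nat.modEq_iff_dvd' h1).mp (Nat.ModEq.pow_card_sub_one_eq_one hp hcop).symm
  have h4 : 4 ≤ 2 ^ (p - 1) :=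
    calc 4 = 2 ^ 2 := by norm_num
      _ ≤ 2 ^ (p - 1) := Nat.pow_le_pow_right (by norm_num) (by omega)
  have hnot : ¬ p ∣ 2 ^ (p - 1) := by
    intro h'
    exact hp2 ((Nat.prime_dvd_prime_iff_eq hp Nat.prime_two).mp (hp.dvd_of_dvd_pow h'))
  have hlte := padicValNat.pow_sub_pow (hp.odd_of_ne_two hp2) (show 1 < 2 ^ (p - 1) by omega)
    (by simpa using hF) hnot (show k ≠ 0 by omega)
  rw [one_pow, ← pow_mul] at hlte
  have hbig : 2 ^ ((p - 1) * k) - 1 ≠ 0 := by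
    have : 2 ^ (p - 1) ≤ 2 ^ ((p - 1) * k) := Nat.pow_le_pow_right (by norm_num) (Nat.le_mul_of_pos_right _ hk)
    omega
  have hd' : p ^ m ∣ 2 ^ ((p - 1) * k) - 1 := by
    refine hd.trans ?_
    simpa [one_pow, mul_comm] using Nat.pow_sub_pow_dvd_pow_sub_pow 2 1 (Dvd.intro_left (p - 1) rfl : k ∣ (p - 1) * k)
  have hm : m ≤ padicValNat p (2 ^ ((p - 1) * k) - 1) := (padicValNat_dvd_iff_le hbig).mp hd'
  rw [hlte] at hm
  have hpk : p ^ padicValNat p k ≤ k := Nat.le_of_dvd (by omega) pow_padicValNat_dvd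
  calc p ^ m ≤ p ^ (padicValNat p (2 ^ (p - 1) - 1) + padicValNat p k) := Nat.pow_le_pow_right hp.pos hm
    _ = p ^ padicValNat p (2 ^ (p - 1) - 1) * p ^ padicValNat p k := by rw [pow_add]
    _ ≤ p ^ padicValNat p (2 ^ (p - 1) - 1) * k := Nat.mul_le_mul_left _ hpk

/-- **Shape F in terms of Wieferich levels** (unconditional): `2^k - 1 = p^m q^n` ⇒ `2^k ≤ W₂(p)·W₂(q)·k² + 1`. -/
theorem shapeF_level {k m n p q : ℕ} (hp : p.Prime) (hq : q.Prime) (hp2 : p ≠ 2) (hq2 : q ≠ 2) (hk : 1 ≤ k)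
    (h : 2 ^ k - 1 = p ^ m * q ^ n) : 2 ^ k ≤ p ^ padicValNat p (2 ^ (p - 1) - 1) * q ^ padicValNat q (2 ^ (q - 1) - 1) * k ^ 2 + 1 := by
  have hpm : p ^ m ≤ p ^ padicValNat p (2 ^ (p - 1) - 1) * k :=
    prime_pow_le_level_mul hp hp2 hk (h ▸ Dvd.intro _ rfl)
  have hqn : q ^ n ≤ q ^ padicValNat q (2 ^ (q - 1) - 1) * k :=
    prime_pow_le_level_mul hq hq2 hk (h ▸ Dvd.intro_left _ rfl)
  have : p ^ m * q ^ n ≤ p ^ padicValNat p (2 ^ (p - 1) - 1) * k * (q ^ padicValNat q (2 ^ (q - 1) - 1) * k) := Nat.mul_le_mul hpm hqn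
  have h1 : 1 ≤ 2 ^ k := Nat.one_le_two_pow
  have : 2 ^ k - 1 ≤ p ^ padicValNat p (2 ^ (p - 1) - 1) * q ^ padicValNat q (2 ^ (q - 1) - 1) * k ^ 2 := by rw [h]; nlinarith
  omega

/-- **Shape E in terms of Wieferich levels** (unconditional): `2^k + 1 = p^m q^n` ⇒ `2^k + 1 ≤ 4·W₂(p)·W₂(q)·k² + 1`. -/
theorem shapeE_level {k m n p q : ℕ} (hp : p.Prime) (hq : q.Prime) (hp2 : p ≠ 2) (hq2 : q ≠ 2) (hk : 1 ≤ k)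
    (h : 2 ^ k + 1 = p ^ m * q ^ n) : 2 ^ k + 1 ≤ 4 * p ^ padicValNat p (2 ^ (p - 1) - 1) * q ^ padicValNat q (2 ^ (q - 1) - 1) * k ^ 2 + 1 := by
  have hfac : 2 ^ (2 * k) - 1 = (2 ^ k - 1) * (2 ^ k + 1) := by
    have h1 : 1 ≤ 2 ^ k := Nat.one_le_two_pow
    have h3 : 1 ≤ 2 ^ (2 * k) := Nat.one_le_two_pow
    zify [h1, h3]
    ring
  have hE : 2 ^ k + 1 ∣ 2 ^ (2 * k) - 1 := hfac ▸ Dvd.intro_left _ rfl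
  have hpm : p ^ m ≤ p ^ padicValNat p (2 ^ (p - 1) - 1) * (2 * k) :=
    prime_pow_le_level_mul hp hp2 (by omega) ((h ▸ Dvd.intro _ rfl : p ^ m ∣ 2 ^ k + 1).trans hE)
  have hqn : q ^ n ≤ q ^ padicValNat q (2 ^ (q - 1) - 1) * (2 * k) :=
    prime_pow_le_level_mul hq hq2 (by omega) ((h ▸ Dvd.intro_left _ rfl : q ^ n ∣ 2 ^ k + 1).trans hE)
  have : p ^ m * q ^ n ≤ p ^ padicValNat p (2 ^ (p - 1) - 1) * (2 * k) * (q ^ padicValNat q (2 ^ (q - 1) - 1) * (2 * k)) := Nat.mul_le_mul hpm hqn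
  rw [h]
  nlinarith

/-- For an odd non-Wieferich prime the level is `p` itself. -/
theorem level_eq_self {p : ℕ} (hp : p.Prime) (hp2 : p ≠ 2) (hW : ¬ p ^ 2 ∣ 2 ^ (p - 1) - 1) :
    p ^ padicValNat p (2 ^ (p - 1) - 1) = p := by
  haveI := Fact.mk hp
  have hp3 : 3 ≤ p := by have := hp.two_le; omega
  have hF : p ∣ 2 ^ (p - 1) - 1 := by
    have hcop : Nat.Coprime 2 p := (Nat.coprime_primes Nat.prime_two hp).mpr hp2.symm
    have h1 : 1 ≤ 2 ^ (p - 1) := Nat.one_le_two_pow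
    exact (Nat.modEq_iff_dvd' h1).mp (Nat.ModEq.pow_card_sub_one_eq_one hp hcop).symm
  have h4 : 4 ≤ 2 ^ (p - 1) :=
    calc 4 = 2 ^ 2 := by norm_num
      _ ≤ 2 ^ (p - 1) := Nat.pow_le_pow_right (by norm_num) (by omega)
  have hne : 2 ^ (p - 1) - 1 ≠ 0 := by omega
  have hv1 : padicValNat p (2 ^ (p - 1) - 1) ≤ 1 := by
    by_contra hlt
    exact hW ((padicValNat_dvd_iff_le hne).mpr (by omega))
  have hv1' : 1 ≤ padicValNat p (2 ^ (p - 1) - 1) :=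
    (padicValNat_dvd_iff_le hne).mp (by simpa using hF)
  rw [show padicValNat p (2 ^ (p - 1) - 1) = 1 by omega, pow_one]

end Summit.ABC.ABC.Theorems
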